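import Mathlib.LinearAlgebra.Matrix.Determinant.Basic
import Mathlib.GroupTheory.Perm.Support
import Mathlib.Algebra.Group.Nat.Even
import Mathlib.Data.Finset.Card
import Mathlib.Tactic.Linarith
import Mathlib.Tactic.Ring
import Mathlib.Tactic.LinearCombination
import HarnessLib

/-!
# Crux `Capture` (stmt-PneNP-2659) — the T-JOIN door is ONE GRANK gate: pairings and odd alternating
# determinants

Two elementary ingredients of `pairConnected_isGRankGate`:

* `exists_perm_pairing_of_even_fibers` — if every fibre of a labelling `cls : Fin k → β` has even size,
  there is a fixed-point-free involution of `Fin k` preserving the labels (pair up inside each fibre;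
  induction on the set still to be paired);
* `det_eq_zero_of_transpose_eq_neg_of_odd` — an alternating matrix of odd size over a commutative ring in
  which `2` is not a zero divisor has determinant zero (`det M = det Mᵀ = det (−M) = −det M`).

[folklore]
-/

namespace Summit.PneNP.PneNP.Theorems.Capture.TJoin

set_option linter.dupNamespace false -- `Summit.PneNP.PneNP.…`: summit = sub-problem (D-0017)

open Finset Matrix

/-! ### Pairing up even fibres -/

/-- **Pairing inside even fibres, relative version**: for a finite set `s` all of whose fibres under
`cls` are even there is a label-preserving involution of `Fin k` without fixed points on `s`, mapping `s`
to `s` and fixing the complement. [folklore] -/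
theorem exists_perm_pairing_finset {k : ℕ} {β : Type*} [DecidableEq β] (cls : Fin k → β) :
    ∀ s : Finset (Fin k), (∀ b, Even ((s.filter fun j => cls j = b).card)) →
      ∃ σ : Equiv.Perm (Fin k), (∀ j ∈ s, σ j ≠ j ∧ σ j ∈ s) ∧ (∀ j ∉ s, σ j = j) ∧
        (∀ j, σ (σ j) = j) ∧ ∀ j, cls (σ j) = cls j := by
  intro s
  induction s using Finset.strongInduction with
  | H s ih =>
    intro heven
    rcases s.eq_empty_or_nonempty with hs | ⟨a, ha⟩
    · subst hs
      exact ⟨1, fun j hj => absurd hj (Finset.notMem_empty j), fun j _ => rfl, fun j => rfl, fun j => rfl⟩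
    · -- a partner `a'` of `a` in the same fibre
      have hfa : 2 ≤ (s.filter fun j => cls j = cls a).card := by
        have hmem : a ∈ s.filter fun j => cls j = cls a := Finset.mem_filter.2 ⟨ha, rfl⟩
        have hpos : 0 < (s.filter fun j => cls j = cls a).card := Finset.card_pos.2 ⟨a, hmem⟩
        obtain ⟨r, hr⟩ := heven (cls a)
        omega
      obtain ⟨a', ha', hne⟩ : ∃ a' ∈ s.filter (fun j => cls j = cls a), a' ≠ a := by
        by_contra hcon
        push Not at hcon
        have hsub : (s.filter fun j => cls j = cls a) ⊆ {a} := fun x hx =>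
          Finset.mem_singleton.2 (hcon x hx)
        have := Finset.card_le_card hsub
        rw [Finset.card_singleton] at this
        omega
      rw [Finset.mem_filter] at ha'
      obtain ⟨ha's, hcls⟩ := ha'
      -- remove the pair and recurse
      set s' := (s.erase a).erase a' with hs'
      have hss : s' ⊂ s :=
        (Finset.erase_subset _ _).trans_ssubset (Finset.erase_ssubset ha)
      have hmem_s' : ∀ j, j ∈ s' ↔ j ∈ s ∧ j ≠ a ∧ j ≠ a' := fun j => by
        simp only [hs', Finset.mem_erase]
        tauto
      have heven' : ∀ b, Even ((s'.filter fun j => cls j = b).card) := by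
        intro b
        by_cases hb : b = cls a
        · -- the fibre of `a` loses exactly `a` and `a'`
          have hset : (s'.filter fun j => cls j = b) = ((s.filter fun j => cls j = b).erase a).erase a' := by
            ext j
            simp only [Finset.mem_filter, Finset.mem_erase, hmem_s']
            tauto
          rw [hset]
          have h1 : a ∈ s.filter (fun j => cls j = b) := Finset.mem_filter.2 ⟨ha, hb ▸ rfl⟩
          have h2 : a' ∈ (s.filter fun j => cls j = b).erase a :=
            Finset.mem_erase.2 ⟨hne, Finset.mem_filter.2 ⟨ha's, hb ▸ hcls⟩⟩
          rw [Finset.card_erase_of_mem h2, Finset.card_erase_of_mem h1]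
          obtain ⟨r, hr⟩ := heven b
          have h2le : 2 ≤ (s.filter fun j => cls j = b).card := by rw [hb]; exact hfa
          exact ⟨r - 1, by omega⟩
        · have hset : (s'.filter fun j => cls j = b) = s.filter fun j => cls j = b := by
            ext j
            simp only [Finset.mem_filter, hmem_s']
            constructor
            · rintro ⟨⟨hj, -, -⟩, hjb⟩
              exact ⟨hj, hjb⟩
            · rintro ⟨hj, hjb⟩
              refine ⟨⟨hj, ?_, ?_⟩, hjb⟩
              · rintro rfl; exact hb hjb.symm
              · rintro rfl; exact hb (hjb.symm.trans hcls)
          rw [hset]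
          exact heven b
      obtain ⟨σ', h1, h2, h3, h4⟩ := ih s' hss heven'
      have hσa : σ' a = a := h2 a (by rw [hmem_s']; tauto)
      have hσa' : σ' a' = a' := h2 a' (by rw [hmem_s']; tauto)
      refine ⟨Equiv.swap a a' * σ', fun j hj => ?_, fun j hj => ?_, fun j => ?_, fun j => ?_⟩
      · by_cases hja : j = a
        · subst hja
          rw [Equiv.Perm.mul_apply, hσa, Equiv.swap_apply_left]
          exact ⟨hne, ha's⟩
        · by_cases hja' : j = a'
          · subst hja'
            rw [Equiv.Perm.mul_apply, hσa', Equiv.swap_apply_right]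
            exact ⟨hne.symm, ha⟩
          · have hjs' : j ∈ s' := (hmem_s' j).2 ⟨hj, hja, hja'⟩
            obtain ⟨hσj, hσjs'⟩ := h1 j hjs'
            obtain ⟨hσjs, hσja, hσja'⟩ := (hmem_s' _).1 hσjs'
            rw [Equiv.Perm.mul_apply, Equiv.swap_apply_of_ne_of_ne hσja hσja']
            exact ⟨hσj, hσjs⟩
      · have hja : j ≠ a := fun h => hj (h ▸ ha)
        have hja' : j ≠ a' := fun h => hj (h ▸ ha's)
        have hjs' : j ∉ s' := fun h => hj ((hmem_s' j).1 h).1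
        rw [Equiv.Perm.mul_apply, h2 j hjs', Equiv.swap_apply_of_ne_of_ne hja hja']
      · simp only [Equiv.Perm.mul_apply]
        by_cases hja : j = a
        · subst hja
          rw [hσa, Equiv.swap_apply_left, hσa', Equiv.swap_apply_right]
        · by_cases hja' : j = a'
          · subst hja'
            rw [hσa', Equiv.swap_apply_right, hσa, Equiv.swap_apply_left]
          · by_cases hjs' : j ∈ s'
            · obtain ⟨-, hσjs'⟩ := h1 j hjs'
              obtain ⟨-, hσja, hσja'⟩ := (hmem_s' _).1 hσjs'
              rw [Equiv.swap_apply_of_ne_of_ne hσja hσja', h3, Equiv.swap_apply_of_ne_of_ne hja hja']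
            · have hfix : σ' j = j := h2 j hjs'
              rw [hfix, Equiv.swap_apply_of_ne_of_ne hja hja', hfix, Equiv.swap_apply_of_ne_of_ne hja hja']
      · rw [Equiv.Perm.mul_apply]
        by_cases h : σ' j = a
        · rw [h, Equiv.swap_apply_left, hcls, ← h, h4]
        · by_cases h' : σ' j = a'
          · rw [h', Equiv.swap_apply_right, ← hcls, ← h', h4]
          · rw [Equiv.swap_apply_of_ne_of_ne h h', h4]

/-- **Pairing up even fibres**: if every fibre of `cls : Fin k → β` has even size, `Fin k` carries a
fixed-point-free involution preserving `cls`. [folklore] -/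
theorem exists_perm_pairing_of_even_fibers : ∀ {k : ℕ} {β : Type} [DecidableEq β] (cls : Fin k → β),
    (∀ b, Even ((Finset.univ.filter fun j => cls j = b).card)) →
    ∃ σ : Equiv.Perm (Fin k), (∀ j, σ j ≠ j) ∧ (∀ j, σ (σ j) = j) ∧ ∀ j, cls (σ j) = cls j := by
  intro k β _ cls heven
  obtain ⟨σ, h1, -, h3, h4⟩ := exists_perm_pairing_finset cls Finset.univ heven
  exact ⟨σ, fun j => (h1 j (Finset.mem_univ j)).1, h3, h4⟩

/-- Conversely, a label-preserving fixed-point-free involution forces every fibre to be even (the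
involution restricts to a fixed-point-free involution of the fibre). [folklore] -/
theorem even_fiber_of_perm_pairing {k : ℕ} {β : Type*} [DecidableEq β] (cls : Fin k → β)
    (σ : Equiv.Perm (Fin k)) (h1 : ∀ j, σ j ≠ j) (h2 : ∀ j, σ (σ j) = j) (h3 : ∀ j, cls (σ j) = cls j)
    (b : β) : Even ((Finset.univ.filter fun j => cls j = b).card) := by
  classical
  -- split the fibre into `{j : j < σ j}` and its image under `σ`
  set F := Finset.univ.filter fun j : Fin k => cls j = b with hF
  set A := F.filter fun j => j < σ j with hA
  set B := F.filter fun j => σ j < j with hB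
  have hdisj : Disjoint A B := by
    rw [Finset.disjoint_filter]
    intro j _ h h'
    exact lt_asymm h h'
  have hunion : A ∪ B = F := by
    ext j
    simp only [hA, hB, Finset.mem_union, Finset.mem_filter]
    constructor
    · rintro (⟨h, -⟩ | ⟨h, -⟩) <;> exact h
    · intro h
      rcases lt_trichotomy j (σ j) with hlt | heq | hgt
      · exact Or.inl ⟨h, hlt⟩
      · exact absurd heq.symm (h1 j)
      · exact Or.inr ⟨h, hgt⟩
  have hcard : A.card = B.card := by
    refine Finset.card_bij (fun j _ => σ j) (fun j hj => ?_) (fun j₁ _ j₂ _ h => σ.injective h)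
      (fun j hj => ?_)
    · rw [hA, Finset.mem_filter, hF, Finset.mem_filter] at hj
      rw [hB, Finset.mem_filter, hF, Finset.mem_filter, h3, h2]
      exact ⟨⟨Finset.mem_univ _, hj.1.2⟩, hj.2⟩
    · rw [hB, Finset.mem_filter, hF, Finset.mem_filter] at hj
      refine ⟨σ j, ?_, h2 j⟩
      rw [hA, Finset.mem_filter, hF, Finset.mem_filter, h3, h2]
      exact ⟨⟨Finset.mem_univ _, hj.1.2⟩, hj.2⟩
  rw [← hunion, Finset.card_union_of_disjoint hdisj, hcard]
  exact ⟨B.card, rfl⟩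

/-! ### Odd alternating determinants vanish -/

/-- **An alternating matrix of odd size has determinant zero** (over a commutative ring without
`2`-torsion): `det M = det Mᵀ = det (−M) = (−1)^{odd} det M`. [folklore] -/
theorem det_eq_zero_of_transpose_eq_neg_of_odd {ι R : Type*} [Fintype ι] [DecidableEq ι] [CommRing R]
    [NoZeroDivisors R] [CharZero R] (M : Matrix ι ι R) (hM : Mᵀ = -M) (hodd : Odd (Fintype.card ι)) :
    M.det = 0 := by
  have h : M.det = (-1) ^ Fintype.card ι * M.det := by
    conv_lhs => rw [← Matrix.det_transpose, hM, Matrix.det_neg]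
  rw [hodd.neg_one_pow] at h
  have h2 : (2 : R) * M.det = 0 := by linear_combination h
  rcases mul_eq_zero.1 h2 with h0 | h0
  · exact absurd h0 two_ne_zero
  · exact h0

end Summit.PneNP.PneNP.Theorems.Capture.TJoin
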